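import Literature.NumberTheory.LFunctions.MertensThirdUpperChain
import HarnessLib

/-!
# RH-FREE kernel certificate — «nothing here bears on the truth of RH»
# Rosser–Schoenfeld's (3.29) below `3 659 203`: certified run of the product upper chain, chunks 11–15
# (primes `2063741 → 3196909`)

Topic: `Literature/NumberTheory/LFunctions`. Pure proof file (kernel computation; nothing is asserted, no definition).
Each `runK` evaluates `MertensThirdUpperChain.runD 15333` — `15333` steps along the prime table `ChainTable.table`,
each certifying the next prime `p'`, performing the comparison `cmp` behind (3.29)
`∏_{p ≤ x} p/(p−1) < e^γ log x (1 + 1/(2 log² x))` on `[p, p') ∩ [286, ∞)`, extending the enclosures of `log p'`,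
`log log p'`, and adding the upper enclosure of `log(p'/(p'−1))`. The four files `MertensThirdUpperChainRun1–4.lean`
(chunks 1–17, primes `3 → 3659203`) carry the certificate past Dusart's threshold `3 594 641`
(assembly: `MertensThirdUpperBound.lean`). The expected states were obtained by evaluating the same function compiled
(`#eval` on the Lean farm, 2026-08-28; all comparisons pass). `decide +kernel`, standard axioms only (`maxHeartbeats 0`).

## References
* J. B. Rosser, L. Schoenfeld, Illinois J. Math. 6 (1962), 64–94: Thm 8 (3.29), p. 70; §8 p. 87 (tables below 10⁸).
  [RosserSchoenfeld1962]
-/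

namespace Literature.NumberTheory.LFunctions.MertensThirdUpperChainRun

open MertensThirdUpperChain

set_option maxHeartbeats 0 in
/-- **Chunk 11 of the certified product upper run** (primes `2063741` to `2287613`).
[cite: RosserSchoenfeld1962, Thm. 8 (3.29) and §8 p. 87] -/
theorem run11 :
    runD 15333
      ⟨2063741, 17577818788978594365443835, 17577818788979069975295767,
        3236180288846491774256043, 3934057689504062723072588⟩ =
    some ⟨2287613, 17702324319019170480344994, 17702324319019646090559893,
        3244713052760767151802450, 3942585407986316592468712⟩ := by
  decide +kernel

set_option maxHeartbeats 0 in
/-- **Chunk 12 of the certified product upper run** (primes `2287613` to `2513557`).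
[cite: RosserSchoenfeld1962, Thm. 8 (3.29) and §8 p. 87] -/
theorem run12 :
    runD 15333
      ⟨2287613, 17702324319019170480344994, 17702324319019646090559893,
        3244713052760767151802450, 3942585407986316592468712⟩ =
    some ⟨2513557, 17816193000357543749034675, 17816193000358019359612176,
        3252464460313808483947093, 3950312541597560786137409⟩ := by
  decide +kernel

set_option maxHeartbeats 0 in
/-- **Chunk 13 of the certified product upper run** (primes `2513557` to `2740141`).
[cite: RosserSchoenfeld1962, Thm. 8 (3.29) and §8 p. 87] -/
theorem run13 :
    runD 15333
      ⟨2513557, 17816193000357543749034675, 17816193000358019359612176,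
        3252464460313808483947093, 3950312541597560786137409⟩ =
    some ⟨2740141, 17920535989283446663496891, 17920535989283922274436404,
        3259524047837284216728794, 3957374098867618429857601⟩ := by
  decide +kernel

set_option maxHeartbeats 0 in
/-- **Chunk 14 of the certified product upper run** (primes `2740141` to `2968027`).
[cite: RosserSchoenfeld1962, Thm. 8 (3.29) and §8 p. 87] -/
theorem run14 :
    runD 15333
      ⟨2740141, 17920535989283446663496891, 17920535989283922274436404,
        3259524047837284216728794, 3957374098867618429857601⟩ =
    some ⟨2968027, 18017114707590501689633511, 18017114707590977300935016,
        3266021789129976186425405, 3963873022700874920548526⟩ := by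
  decide +kernel

set_option maxHeartbeats 0 in
/-- **Chunk 15 of the certified product upper run** (primes `2968027` to `3196909`).
[cite: RosserSchoenfeld1962, Thm. 8 (3.29) and §8 p. 87] -/
theorem run15 :
    runD 15333
      ⟨2968027, 18017114707590501689633511, 18017114707590977300935016,
        3266021789129976186425405, 3963873022700874920548526⟩ =
    some ⟨3196909, 18106922159628504133144670, 18106922159628979744800957,
        3272032787448044143646235, 3969889061063892384496273⟩ := by
  decide +kernel

end Literature.NumberTheory.LFunctions.MertensThirdUpperChainRun
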